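import Literature.Geometry.GeometricMeasureTheory.PushforwardCurrent
import Literature.Geometry.GeometricMeasureTheory.ApproxTangentChart
import Literature.Geometry.GeometricMeasureTheory.RectifiableAdd
import Mathlib.Analysis.Calculus.ContDiff.RCLike

/-!
# Chart images with a linear left inverse as rectifiable currents

Let `g : P → V` be `C¹` between finite-dimensional real inner product spaces (`dim P = n`) and
`π : V →L[ℝ] P` a continuous linear **left inverse of `g` on an open set `Q`** (`π (g s) = s` for
`s ∈ Q`) — e.g. a graph `g = ι + u` over a complemented slice `ι(P)`, `π ∘ ι = id`, `π ∘ u = 0`.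
Then `g` is an injective immersion on `Q`, and:

* `approxTangentCone_eq_range_fderiv_of_lipschitz` — the chart theorem of
  `ApproxTangentChart.lean` (Federer 3.2.19 at every point of a chart image) for a left inverse
  with ANY Lipschitz constant (reduction to constant `1` by dilating the parameter space);
* `approxTangentCone_image_eq_of_leftInverse` : `Tan^n(𝓗ⁿ ⌞ g(Q), g t) = im Dg(t)` for `t ∈ Q`;
* `isRectifiableData_image_of_leftInverse` : `(g(Q), k, ξ)` — `ξ` the Gram–Schmidt push-forward
  frame — is admissible rectifiable data on any open `Ω ⊇ g(Q)` (`Q` bounded, `Dg` bounded on `Q`),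
  `currentOfIntegration_image_apply_of_leftInverse` : `[g(Q), k, ξ](φ) = k ∫_Q φ(g x)(Dg(x) e) dx`,
  and `isRectifiable_currentOfIntegration_image` : it is a rectifiable current when
  `closure g(Q) ⊆ Ω` (Federer 4.1.25, 4.1.28 for embedded chart pieces).

## References

* H. Federer, *Geometric Measure Theory*, Springer 1969, 3.2.19, 4.1.25, 4.1.28 [Federer1969].
-/

noncomputable section

open scoped InnerProductSpace ENNReal NNReal Topology Pointwise
open MeasureTheory Measure Set Function Module InnerProductSpace TopologicalSpace Filter Metric

namespace Literature.Geometry.GeometricMeasureTheory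

open Literature.Analysis.Calculus

-- Nested operator-norm instances on (duals of) `V [⋀^Fin n]→L[ℝ] ℝ`.
set_option maxSynthPendingDepth 2

/-! ### The chart theorem with an arbitrary Lipschitz constant -/

section Rescale

variable {P : Type*} [NormedAddCommGroup P] [InnerProductSpace ℝ P] [FiniteDimensional ℝ P]
  [MeasurableSpace P] [BorelSpace P]
  {V : Type*} [NormedAddCommGroup V] [NormedSpace ℝ V] [MeasurableSpace V] [BorelSpace V]
  {G : Type*} [NormedAddCommGroup G] [NormedSpace ℝ G]

/-- **The approximate tangent cone of a chart image is the tangent space** — version of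
`approxTangentCone_eq_range_fderiv` with a `K`-Lipschitz left inverse `ℓ` (`K > 0` arbitrary):
precomposing the chart with the dilation `s ↦ K s` of `P` and dividing `ℓ` by `K` reduces to
`K = 1`. [cite: Federer1969, 3.2.19] -/
theorem approxTangentCone_eq_range_fderiv_of_lipschitz {ℓ : V → P} {K : ℝ≥0} (hK : 0 < K)
    (hℓ : LipschitzWith K ℓ) {g : P → V} {W : Set P} {t : P} (hW : W ∈ 𝓝 t) {L : ℝ≥0}
    (hg : LipschitzOnWith L g W) (hℓg : ∀ s ∈ W, ℓ (g s) = s) {g' : P →L[ℝ] V}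
    (hd : HasFDerivAt g g' t) {C : Set V} (hC : g '' W ⊆ C) (hCm : MeasurableSet C)
    {U : Set V} (hUm : MeasurableSet U) (hU : U ∈ 𝓝 (g t))
    {F : V → G} {F' : V →L[ℝ] G} (hF : HasFDerivAt F F' (g t))
    (hCU : C ∩ U ⊆ {z | F z = F (g t)}) (hker : ∀ y, F' y = 0 → y ∈ range g') :
    approxTangentCone (finrank ℝ P) ((μHE[finrank ℝ P] : Measure V).restrict C) (g t) =
      range g' := by
  set c : ℝ := (K : ℝ) with hc
  have hc0 : 0 < c := by exact_mod_cast hK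
  have hcne : c ≠ 0 := hc0.ne'
  -- the rescaled chart
  set gc : P → V := fun s => g (c • s) with hgc
  set ℓc : V → P := fun y => c⁻¹ • ℓ y with hℓc
  set tc : P := c⁻¹ • t with htc
  have hctc : c • tc = t := by rw [htc, smul_inv_smul₀ hcne]
  have hgt : gc tc = g t := by simp only [hgc, hctc]
  set Wc : Set P := (fun s => c • s) ⁻¹' W with hWc
  have hWc_nhds : Wc ∈ 𝓝 tc :=
    (continuous_const_smul c).continuousAt.preimage_mem_nhds (by rwa [hctc])
  have hℓc1 : LipschitzWith 1 ℓc := by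
    refine LipschitzWith.of_dist_le_mul fun y y' => ?_
    rw [hℓc, dist_smul₀, norm_inv, Real.norm_of_nonneg hc0.le, NNReal.coe_one, one_mul]
    calc c⁻¹ * dist (ℓ y) (ℓ y') ≤ c⁻¹ * (K * dist y y') :=
          mul_le_mul_of_nonneg_left (hℓ.dist_le_mul y y') (inv_nonneg.2 hc0.le)
      _ = dist y y' := by rw [← hc, ← mul_assoc, inv_mul_cancel₀ hcne, one_mul]
  have hgcL : LipschitzOnWith (L * K) gc Wc := by
    refine LipschitzOnWith.of_dist_le_mul fun s hs s' hs' => ?_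
    calc dist (gc s) (gc s') ≤ L * dist (c • s) (c • s') := hg.dist_le_mul _ hs _ hs'
      _ = L * K * dist s s' := by
          rw [dist_smul₀, Real.norm_of_nonneg hc0.le, hc]; ring
  have hℓcgc : ∀ s ∈ Wc, ℓc (gc s) = s := by
    intro s hs
    simp only [hℓc, hgc, hℓg _ hs, inv_smul_smul₀ hcne]
  have hdc : HasFDerivAt gc (g'.comp (c • ContinuousLinearMap.id ℝ P)) tc := by
    have h1 : HasFDerivAt (fun s : P => c • s) (c • ContinuousLinearMap.id ℝ P) tc :=
      (hasFDerivAt_id tc).const_smul c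
    have h2 : HasFDerivAt g g' (c • tc) := by rwa [hctc]
    exact h2.comp tc h1
  have hCc : gc '' Wc ⊆ C := by
    rintro _ ⟨s, hs, rfl⟩
    exact hC ⟨c • s, hs, rfl⟩
  have hrange : range (g'.comp (c • ContinuousLinearMap.id ℝ P)) = range g' := by
    ext y
    constructor
    · rintro ⟨w, rfl⟩
      exact ⟨c • w, by simp⟩
    · rintro ⟨w, rfl⟩
      refine ⟨c⁻¹ • w, ?_⟩
      simp [smul_smul, inv_mul_cancel₀ hcne]
  have hkerc : ∀ y, F' y = 0 → y ∈ range (g'.comp (c • ContinuousLinearMap.id ℝ P)) := by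
    intro y hy
    rw [hrange]
    exact hker y hy
  have key := approxTangentCone_eq_range_fderiv hℓc1 hWc_nhds hgcL hℓcgc hdc hCc hCm hUm
    (by rwa [hgt]) (F := F) (F' := F') (by rwa [hgt]) (by rwa [hgt]) hkerc
  rwa [hgt, hrange] at key

end Rescale

/-! ### Charts with a linear left inverse -/

section LeftInverse

variable {P : Type*} [NormedAddCommGroup P] [InnerProductSpace ℝ P] [FiniteDimensional ℝ P]
  [MeasurableSpace P] [BorelSpace P]
  {V : Type*} [NormedAddCommGroup V] [InnerProductSpace ℝ V] [FiniteDimensional ℝ V]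
  [MeasurableSpace V] [BorelSpace V] {n : ℕ}
  {g : P → V} {π : V →L[ℝ] P} {Q : Set P}

omit [FiniteDimensional ℝ P] [MeasurableSpace P] [BorelSpace P] [FiniteDimensional ℝ V]
  [MeasurableSpace V] [BorelSpace V] in
/-- Differentiating `π ∘ g = id` on the open set `Q`: `π ∘ Dg(x) = id`. [folklore] -/
theorem comp_fderiv_eq_of_leftInverse (hg : ContDiff ℝ 1 g) (hπ : ∀ s ∈ Q, π (g s) = s)
    (hQ : IsOpen Q) {x : P} (hx : x ∈ Q) (w : P) : π (fderiv ℝ g x w) = w := by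
  have hd : HasFDerivAt g (fderiv ℝ g x) x := (hg.differentiable one_ne_zero).differentiableAt.hasFDerivAt
  have h1 : HasFDerivAt (fun s => π (g s)) (π.comp (fderiv ℝ g x)) x := π.hasFDerivAt.comp x hd
  have h2 : HasFDerivAt (fun s => π (g s)) (ContinuousLinearMap.id ℝ P) x :=
    (hasFDerivAt_id x).congr_of_eventuallyEq (eventually_of_mem (hQ.mem_nhds hx) fun s hs => hπ s hs)
  have := h1.unique h2
  simpa using congrArg (fun A : P →L[ℝ] P => A w) this

omit [FiniteDimensional ℝ P] [MeasurableSpace P] [BorelSpace P] [FiniteDimensional ℝ V]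
  [MeasurableSpace V] [BorelSpace V] in
/-- The differential of a chart with a left inverse is injective. [folklore] -/
theorem injective_fderiv_of_leftInverse (hg : ContDiff ℝ 1 g) (hπ : ∀ s ∈ Q, π (g s) = s)
    (hQ : IsOpen Q) {x : P} (hx : x ∈ Q) : Injective (fderiv ℝ g x) := fun a b h => by
  rw [← comp_fderiv_eq_of_leftInverse hg hπ hQ hx a, ← comp_fderiv_eq_of_leftInverse hg hπ hQ hx b,
    h]

omit [FiniteDimensional ℝ V] in
/-- **The approximate tangent cone of a chart image with a linear left inverse is the tangent
space**, at every point: `Tan^n(𝓗ⁿ ⌞ g(Q), g t) = im Dg(t)` for `Q` open, `t ∈ Q`.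
[cite: Federer1969, 3.2.19] -/
theorem approxTangentCone_image_eq_of_leftInverse (hg : ContDiff ℝ 1 g)
    (hπ : ∀ s ∈ Q, π (g s) = s) (hQ : IsOpen Q) {t : P} (ht : t ∈ Q) :
    approxTangentCone (finrank ℝ P) ((μHE[finrank ℝ P] : Measure V).restrict (g '' Q)) (g t) =
      Set.range (fderiv ℝ g t) := by
  set g' : P →L[ℝ] V := fderiv ℝ g t with hg'
  have hgd : ∀ x, HasFDerivAt g (fderiv ℝ g x) x := fun x =>
    (hg.differentiable one_ne_zero).differentiableAt.hasFDerivAt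
  -- `g` is Lipschitz near `t`, inside `Q`
  obtain ⟨L, W₀, hW₀, hLip⟩ := (hg.contDiffAt (x := t)).exists_lipschitzOnWith
  have hW : W₀ ∩ Q ∈ 𝓝 t := inter_mem hW₀ (hQ.mem_nhds ht)
  have hgW : LipschitzOnWith L g (W₀ ∩ Q) := hLip.mono inter_subset_left
  have hℓg : ∀ s ∈ W₀ ∩ Q, π (g s) = s := fun s hs => hπ s hs.2
  have hC : g '' (W₀ ∩ Q) ⊆ g '' Q := image_mono inter_subset_right
  have hCm : MeasurableSet (g '' Q) :=
    hQ.measurableSet.image_of_continuousOn_injOn hg.continuous.continuousOn (LeftInvOn.injOn hπ)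
  -- the level set `F y = y - g (π y)` near `g t`
  set F : V → V := fun y => y - g (π y) with hF
  have hFd : HasFDerivAt F (ContinuousLinearMap.id ℝ V - g'.comp π) (g t) := by
    have h1 : HasFDerivAt (fun y => g (π y)) ((fderiv ℝ g (π (g t))).comp π) (g t) :=
      (hgd (π (g t))).comp (g t) π.hasFDerivAt
    rw [hπ t ht] at h1
    exact (hasFDerivAt_id (g t)).sub h1
  -- `U = π⁻¹(Q)`: there `F` vanishes on the chart image
  have hUo : IsOpen (π ⁻¹' Q) := hQ.preimage π.continuous
  have hU : π ⁻¹' Q ∈ 𝓝 (g t) := hUo.mem_nhds (by simp [hπ t ht, ht])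
  have hCU : g '' Q ∩ π ⁻¹' Q ⊆ {z | F z = F (g t)} := by
    rintro _ ⟨⟨s, hs, rfl⟩, -⟩
    simp only [mem_setOf_eq, hF, hπ s hs, hπ t ht, sub_self]
  have hker : ∀ y, (ContinuousLinearMap.id ℝ V - g'.comp π) y = 0 → y ∈ Set.range g' := by
    intro y hy
    refine ⟨π y, ?_⟩
    rw [_root_.sub_apply, sub_eq_zero] at hy
    exact hy.symm
  -- Lipschitz constant of `π`
  have hKpos : 0 < max ‖π‖₊ 1 := lt_max_of_lt_right one_pos
  have hπL : LipschitzWith (max ‖π‖₊ 1) π := π.lipschitz.weaken (le_max_left _ _)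
  exact approxTangentCone_eq_range_fderiv_of_lipschitz hKpos hπL hW hgW hℓg (hgd t) hC hCm
    hUo.measurableSet hU hFd hCU hker

/-- **Chart pieces are admissible rectifiable data**: for `Q` open and bounded with `Dg` bounded
on `Q`, an open `Ω ⊇ g(Q)` and the Gram–Schmidt push-forward frame `ξ`, the triple
`(g(Q), k, ξ)` satisfies `IsRectifiableData` (measurable, countably `n`-rectifiable, finite mass,
`ξ` orthonormal with `span ξ = Tan^n` at EVERY point of `g(Q)`). [cite: Federer1969, 4.1.28, 3.2.19] -/
theorem isRectifiableData_image_of_leftInverse (e : OrthonormalBasis (Fin n) ℝ P)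
    (hg : ContDiff ℝ 1 g) (hπ : ∀ s ∈ Q, π (g s) = s) (hQ : IsOpen Q)
    (hQb : Bornology.IsBounded Q) {C : ℝ} (hC : ∀ x ∈ Q, ‖fderiv ℝ g x‖ ≤ C)
    {Ω : Opens V} (hΩ : g '' Q ⊆ Ω) {ξ : V → Fin n → V}
    (hξ : ∀ x ∈ Q, ξ (g x) = gramSchmidtNormed ℝ fun j => fderiv ℝ g x (e j)) (k : ℤ) :
    IsRectifiableData Ω n (g '' Q) (fun _ => k) ξ := by
  have hn := finrank_eq_of_orthonormalBasis_fin e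
  have hgd : ∀ x ∈ Q, HasFDerivWithinAt g (fderiv ℝ g x) Q x := fun x _ =>
    (hg.differentiable one_ne_zero).differentiableAt.hasFDerivAt.hasFDerivWithinAt
  have hinj : ∀ x ∈ Q, Injective (fderiv ℝ g x) := fun x hx =>
    injective_fderiv_of_leftInverse hg hπ hQ hx
  have hgi : InjOn g Q := LeftInvOn.injOn hπ
  have hQm : MeasurableSet Q := hQ.measurableSet
  have hQfin : volume Q ≠ ⊤ := hQb.measure_lt_top.ne
  have hWm := measurableSet_image_of_hasFDerivWithinAt hQm hgd hgi
  refine ⟨hWm, hΩ, isCountablyRectifiable_image_of_hasFDerivWithinAt e hgd, ?_, ?_⟩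
  · have hint := integrableOn_smul_frameVector_image hQm hgd hinj hgi e hξ hC hQfin (k : ℝ)
    exact (hint.integrable.locallyIntegrable).locallyIntegrableOn _
  · rw [ae_restrict_iff' hWm]
    refine Eventually.of_forall ?_
    rintro _ ⟨x, hx, rfl⟩
    rw [hξ x hx]
    refine ⟨orthonormal_gramSchmidtNormed_comp (hinj x hx) e, ?_⟩
    have ht := approxTangentCone_image_eq_of_leftInverse hg hπ hQ hx
    rw [hn] at ht
    rw [ht, span_gramSchmidtNormed_comp, LinearMap.coe_range]
    rfl

/-- **The chart current is the push-forward**: `[g(Q), k, ξ](φ) = k ∫_Q φ(g x)(Dg(x) e) dx`.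
[cite: Federer1969, 4.1.25, 4.1.28] -/
theorem currentOfIntegration_image_apply_of_leftInverse (e : OrthonormalBasis (Fin n) ℝ P)
    (hg : ContDiff ℝ 1 g) (hπ : ∀ s ∈ Q, π (g s) = s) (hQ : IsOpen Q)
    (hQb : Bornology.IsBounded Q) {C : ℝ} (hC : ∀ x ∈ Q, ‖fderiv ℝ g x‖ ≤ C)
    {Ω : Opens V} {ξ : V → Fin n → V}
    (hξ : ∀ x ∈ Q, ξ (g x) = gramSchmidtNormed ℝ fun j => fderiv ℝ g x (e j)) (k : ℤ)
    (φ : TestForm Ω n) :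
    currentOfIntegration (g '' Q) (fun _ => k) ξ φ =
      (k : ℝ) * ∫ x in Q, φ (g x) fun j => fderiv ℝ g x (e j) := by
  have hgd : ∀ x ∈ Q, HasFDerivWithinAt g (fderiv ℝ g x) Q x := fun x _ =>
    (hg.differentiable one_ne_zero).differentiableAt.hasFDerivAt.hasFDerivWithinAt
  have hinj : ∀ x ∈ Q, Injective (fderiv ℝ g x) := fun x hx =>
    injective_fderiv_of_leftInverse hg hπ hQ hx
  exact currentOfIntegration_image_apply hQ.measurableSet hgd hinj (LeftInvOn.injOn hπ) e hξ
    hC hQb.measure_lt_top.ne k φ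

omit [MeasurableSpace P] [BorelSpace P] [MeasurableSpace V] [BorelSpace V] [FiniteDimensional ℝ V]
  [InnerProductSpace ℝ V] in
/-- `closure g(Q)` is compact for bounded `Q` and continuous `g`. [folklore] -/
theorem isCompact_closure_image_of_isBounded [NormedSpace ℝ V] (hg : Continuous g)
    (hQb : Bornology.IsBounded Q) : IsCompact (closure (g '' Q)) := by
  have hK : IsCompact (g '' closure Q) := hQb.isCompact_closure.image hg
  exact hK.of_isClosed_subset isClosed_closure
    (closure_minimal (image_mono subset_closure) hK.isClosed)

/-- **Chart pieces are rectifiable currents** (`𝓡ₙ(Ω)`), provided `closure g(Q) ⊆ Ω`.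
[cite: Federer1969, 4.1.24, 4.1.28] -/
theorem isRectifiable_currentOfIntegration_image (e : OrthonormalBasis (Fin n) ℝ P)
    (hg : ContDiff ℝ 1 g) (hπ : ∀ s ∈ Q, π (g s) = s) (hQ : IsOpen Q)
    (hQb : Bornology.IsBounded Q) {C : ℝ} (hC : ∀ x ∈ Q, ‖fderiv ℝ g x‖ ≤ C)
    {Ω : Opens V} (hΩ : closure (g '' Q) ⊆ Ω) {ξ : V → Fin n → V}
    (hξ : ∀ x ∈ Q, ξ (g x) = gramSchmidtNormed ℝ fun j => fderiv ℝ g x (e j)) (k : ℤ) :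
    (currentOfIntegration (g '' Q) (fun _ => k) ξ : Current Ω n).IsRectifiable := by
  refine ⟨⟨_, _, _, isRectifiableData_image_of_leftInverse e hg hπ hQ hQb hC
    (subset_closure.trans hΩ) hξ k, rfl⟩, ?_⟩
  exact Current.isCompact_support_of_subset _
    (isCompact_closure_image_of_isBounded hg.continuous hQb) hΩ
    (support_currentOfIntegration_subset_closure _ _ _)

end LeftInverse

end Literature.Geometry.GeometricMeasureTheory
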